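import Summits.HodgeConjecture.HodgeConjecture.Theses.PadicSemiregularLift
import Summits.HodgeConjecture.HodgeConjecture.Theorems.NodalThetaWeilFourfoldSupportedClassesAlgebraic
import Summits.HodgeConjecture.HodgeConjecture.Theorems.HodgeBeyondAnchors.Negative.FalseWithoutIsSmoothProjective
import Literature.AlgebraicGeometry.HodgeTheory.LefschetzOneOneHolds
import Literature.AlgebraicGeometry.HodgeTheory.MiddleDimensionReductionHolds

/-!
# Line `MiddleHodgeLadder` for crux `HodgeBeyondAnchors` (stmt-HodgeConjecture-14054) — the ladder DOWN from the top

Forward generator G4 `ladder-down` (planner-fwd-ladder-HodgeConjecture-14054-0, 2026-08-17), route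
`PadicSemiregularLift`.  The crux is kernel-checked EQUIVALENT to the summit
(`Theorems/PadicSemiregularLiftHodgeBeyondAnchorsUnconditional.lean: hodgeBeyondAnchors_iff_hodgeConjecture_holds`),
so we do not attack it; we record its LADDER in the crux's own `(n, p)`-language and the first open rung.

* GRADATION (parameter `m`, the middle index).  `MiddleHodge m` := every rational Hodge class of type
  `(m, m)` on every smooth projective complex variety of dimension `2m` is algebraic — verbatim the
  `m`-slice of the antecedent of the tree's named fact `middleDimensionReduction` (BFNP 2009 §6 Lemma 48,
  DISCHARGED: `middleDimensionReduction_holds`).  The top is `∀ m, MiddleHodge m`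
  (`forall_middleHodge_iff_hodgeConjecture`, proved below from landed theorems only).
* FLOOR `m ≤ 1` (the WITNESS, sorry-free): `middleHodge_zero` (`algebraicClasses_zero`) and
  `middleHodge_one` = Lefschetz's theorem on `(1,1)`-classes on surfaces (tree theorem
  `lefschetzOneOne_rational_holds`, VoisinHodgeI2002 Thm 11.30; Lefschetz 1924, Kodaira–Spencer 1953).
* RUNG `m = 2` = the Hodge conjecture for rational `(2,2)`-classes on smooth projective FOURFOLDS —
  registered stub `stub_middleHodge_two`, stated with the literal `4` exactly as the antecedent of the
  shared crux `SummitGrantedFourfolds` (stmt-HodgeConjecture-14600); it is `MiddleHodge 2` on the nose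
  (`middleHodge_two_iff_stub`, `Iff.rfl`) and it is KERNEL-EQUIVALENT to the open crux
  `LinearSystemTorelli.MiddleDivisorSupportFourfold` (stmt-HodgeConjecture-2409, "every rational
  `(2,2)`-class on a fourfold is supported on a divisor") by the landed theorem
  `nodalThetaWeil_fourfoldSupportedClassesAlgebraic_proof` (stmt-7747: `N¹H⁴ ∩ Hdg ⊆ alg`, divisor
  induction + Lefschetz `(1,1)` on threefolds) and `supportedClasses_mono`
  (`middleHodge_two_iff_middleDivisorSupportFourfold`).  So the first open rung of this crux IS the
  fourfold battleground already filed as stmt-2409 / antecedent of stmt-14599, stmt-14600.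
* GAP = `stub_summitGrantedFourfolds`, verbatim the shared crux `SummitGrantedFourfolds`
  (stmt-HodgeConjecture-14600, routes NoetherLefschetzOneUp / CurveNetMordellWeil): granted the fourfold
  rung, the middle degree of every even dimension `≥ 6` (BFNP Lemma 48 moves everything to the middle:
  `hodgeConjectureFor_of_middleDimension_holds`).  The unconditional tail `∀ m ≥ 3, MiddleHodge m` is NOT
  a stub: it implies the whole summit by itself through `X ↦ X × ℙ²` (refuter note on the retired
  stmt-HodgeConjecture-14417) — the only honest gap item is the conditional one.
* COMPOSITION `HodgeBeyondAnchors_of : HodgeBeyondAnchors` (the ONLY theorem of the file concluding the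
  crux by name, from the two stubs BY NAME, one application; hypothesis form `hodgeConjecture_of_rungs :
  stub₁ → stub₂ → HodgeConjecture` = the typed ladder `Rung 2 → Gap → S`; the anchor exclusions of the
  crux are simply not used — the rung and the gap prove `HodgeConjectureFor` for every smooth projective `X`).
* DISPROOF USED (`Cruxes/HodgeBeyondAnchors/Disproof.lean`, landed
  `Theorems/HodgeBeyondAnchors/Negative/FalseWithoutIsSmoothProjective.lean`): every stub keeps the
  smoothness–projectivity hypothesis with ONE dimension index shared by `IsSmoothProjective` and
  `IsOfHodgeType` (`hodgeBeyondAnchors_false_without_isSmoothProjective`,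
  `hodgeBeyondAnchors_false_with_decoupled_index`): `stub_middleHodge_two` has `IsSmoothProjective 4 X`
  and `IsOfHodgeType 4 X (2 * 2) 2 2 c`.
-/

set_option linter.dupNamespace false

noncomputable section

open Literature.AlgebraicTopology.SingularHomology
open Literature.AlgebraicGeometry.Motives Literature.AlgebraicGeometry.HodgeTheory

namespace Summit.HodgeConjecture.HodgeConjecture.Cruxes.HodgeBeyondAnchors.MiddleHodgeLadder

open Summit.HodgeConjecture.HodgeConjecture.Theses.PadicSemiregularLift
open Summit.HodgeConjecture.HodgeConjecture.Theorems

/-! ## The rung family -/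

/-- **Rung `m` of the middle-degree ladder**: every rational Hodge class of type `(m, m)` on every
smooth projective complex variety of (even) dimension `2m` is algebraic.  Verbatim the `m`-slice of the
antecedent of `Literature.AlgebraicGeometry.HodgeTheory.middleDimensionReduction` (BFNP 2009, Lemma 48).
`m = 0`: trivial; `m = 1`: Lefschetz `(1,1)`; `m = 2`: the fourfold case (OPEN, the rung); the top is
`∀ m`. [cite: BrosnanFangNiePearlstein2009, §6 Lemma 48] [cite: Deligne2000, §1] -/
def MiddleHodge (m : ℕ) : Prop :=
  ∀ ⦃X : SchemeOver ℂ⦄, IsSmoothProjective (2 * m) X →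
    ∀ c : complexBetti X (2 * m), IsRationalClass c → IsOfHodgeType (2 * m) X (2 * m) m m c →
      c ∈ algebraicClasses X m

/-- Rung `0` (floor): in codimension `0` every class is algebraic. [cite: VoisinHodgeI2002, §11.3] -/
theorem middleHodge_zero : MiddleHodge 0 := by
  intro X _ c _ _
  rw [algebraicClasses_zero]
  exact Submodule.mem_top

/-- Rung `1` (the WITNESS = highest proved rung): Lefschetz's theorem on `(1,1)`-classes, on smooth
projective surfaces — the tree THEOREM `lefschetzOneOne_rational_holds` (exponential sequence + GAGA).
[cite: VoisinHodgeI2002, Thm. 11.30] -/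
theorem middleHodge_one : MiddleHodge 1 :=
  fun _X hX c hc h ↦ lefschetzOneOne_rational_holds hX c hc h

/-- The TOP of the ladder is the summit: `(∀ m, MiddleHodge m) ↔ HodgeConjecture` — `→` is BFNP
Lemma 48 discharged in the tree (`hodgeConjectureFor_of_middleDimension_holds`), `←` is the instance
`n = 2m`, `p = m`. [cite: BrosnanFangNiePearlstein2009, §6 Lemma 48] -/
theorem forall_middleHodge_iff_hodgeConjecture : (∀ m, MiddleHodge m) ↔ _root_.HodgeConjecture :=
  ⟨fun h _n _X hX ↦ hodgeConjectureFor_of_middleDimension_holds (fun m _X hX c hc hpp ↦ h m hX c hc hpp) hX,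
    fun h m _X hX c hc hpp ↦ (h hX).2 m c hc hpp⟩

/-! ## Registered stubs -/

/-- **RUNG `m = 2` (stub, OPEN — the first open rung of the ladder): the Hodge conjecture for rational
`(2,2)`-classes on smooth projective complex fourfolds.**  Stated with the literal dimension `4`, verbatim
the antecedent of the shared crux `SummitGrantedFourfolds` (stmt-HodgeConjecture-14600) and of
`FourfoldsGrantedK3Nets` (stmt-14599); `= MiddleHodge 2` (`middleHodge_two_iff_stub`) and kernel-equivalent
to `LinearSystemTorelli.MiddleDivisorSupportFourfold` (stmt-HodgeConjecture-2409)
(`middleHodge_two_iff_middleDivisorSupportFourfold`).  Why it might fail: a Weil class on a general abelian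
fourfold of Weil type with discriminant ≠ 1, or a Mumford–Tate-special class on a hyper-Kähler fourfold,
could be non-algebraic (Markman 2025 settles discriminant 1 / all Weil-type fourfolds per arXiv:2502.03415).
Known sub-rungs: cubic fourfolds (Zucker 1977), quartic/quintic fourfolds and every fourfold with `CH₀`
supported in dimension `≤ 3` (Conte–Murre 1978, Bloch–Srinivas 1983), divisor-supported classes
(stmt-7747, proved), abelian fourfolds (Markman 2025, claim).
[cite: Deligne2000, §1] [cite: Zucker1977CubicFourfolds] [cite: BlochSrinivas1983] -/
theorem stub_middleHodge_two :
    ∀ ⦃X : SchemeOver ℂ⦄, IsSmoothProjective 4 X →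
      ∀ c : complexBetti X (2 * 2), IsRationalClass c → IsOfHodgeType 4 X (2 * 2) 2 2 c →
        c ∈ algebraicClasses X 2 := by
  sorry

/-- **GAP (stub, OPEN — other routes' crux, not worked by this line): the summit granted the fourfold
rung**, verbatim the shared crux `SummitGrantedFourfolds` (stmt-HodgeConjecture-14600; routes
NoetherLefschetzOneUp, CurveNetMordellWeil): BFNP Lemma 48 (`middleDimensionReduction_holds`) puts every
class in the middle degree of an even-dimensional variety; `m ≤ 1` is Lefschetz, `m = 2` is the rung,
`m ≥ 3` is the content of this stub.  Why it might fail: general Weil-type abelian `2n`-folds, `n ≥ 3`,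
carry non-divisorial Hodge classes (van Geemen 1994 Thm 4.11) known algebraic only in special cases;
nothing descends from dimension 4 upward. [cite: BrosnanFangNiePearlstein2009, §6 Lemma 48]
[cite: Deligne2000, §1] -/
theorem stub_summitGrantedFourfolds :
    (∀ ⦃X : SchemeOver ℂ⦄, IsSmoothProjective 4 X →
      ∀ c : complexBetti X (2 * 2), IsRationalClass c → IsOfHodgeType 4 X (2 * 2) 2 2 c →
        c ∈ algebraicClasses X 2) →
    ∀ ⦃n : ℕ⦄ ⦃X : SchemeOver ℂ⦄, IsSmoothProjective n X →
      Nonempty (HodgeModel n X) ∧ ∀ (p : ℕ) (c : complexBetti X (2 * p)), IsRationalClass c →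
        IsOfHodgeType n X (2 * p) p p c → c ∈ algebraicClasses X p := by
  sorry

/-! ## The rung in its three spellings (sorry-free) -/

/-- The stub IS rung `2` of the family (`2 * 2` reduces to `4`). -/
theorem middleHodge_two_iff_stub :
    MiddleHodge 2 ↔
      ∀ ⦃X : SchemeOver ℂ⦄, IsSmoothProjective 4 X →
        ∀ c : complexBetti X (2 * 2), IsRationalClass c → IsOfHodgeType 4 X (2 * 2) 2 2 c →
          c ∈ algebraicClasses X 2 :=
  Iff.rfl

/-- **Rung `2` ⟺ the fourfold battleground crux `MiddleDivisorSupportFourfold` (stmt-HodgeConjecture-2409,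
verbatim)**: `→` because algebraic classes `N²H⁴` lie in `N¹H⁴` (`supportedClasses_mono`); `←` by the
LANDED theorem `nodalThetaWeil_fourfoldSupportedClassesAlgebraic_proof` (stmt-7747: a divisor-supported
rational `(2,2)`-class on a smooth projective fourfold is algebraic — divisor induction at `(3,2)` +
Lefschetz `(1,1)` on threefolds, unconditional). [cite: DeligneHodgeIII1974, Cor. 8.2.8]
[cite: VoisinHodgeI2002, Thm. 11.30] -/
theorem middleHodge_two_iff_middleDivisorSupportFourfold :
    MiddleHodge 2 ↔
      ∀ ⦃X : Literature.AlgebraicGeometry.Motives.SchemeOver ℂ⦄, Literature.AlgebraicGeometry.Motives.IsSmoothProjective 4 X → ∀ c : Literature.AlgebraicGeometry.HodgeTheory.complexBetti X 4, Literature.AlgebraicGeometry.HodgeTheory.IsRationalClass c → Literature.AlgebraicGeometry.HodgeTheory.IsOfHodgeType 4 X 4 2 2 c → c ∈ Literature.AlgebraicGeometry.HodgeTheory.supportedClasses X 4 1 := by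
  constructor
  · intro h X hX c hc hpp
    exact supportedClasses_mono X 4 one_le_two (h hX c hc hpp)
  · intro h X hX c hc hpp
    exact nodalThetaWeil_fourfoldSupportedClassesAlgebraic_proof hX c hc hpp (h hX c hc hpp)

/-- The same equivalence against the filed decl of route `LinearSystemTorelli` is not importable here
without dragging that route's cone; the statement above is its body verbatim (planner check: textual
identity with `Theses/LinearSystemTorelli.lean` l.238). The `NodalThetaWeil` spelling IS imported: -/
theorem middleHodge_two_of_fourfoldSupportedClassesAlgebraic
    (h : ∀ ⦃X : SchemeOver ℂ⦄, IsSmoothProjective 4 X → ∀ c : complexBetti X 4, IsRationalClass c →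
      IsOfHodgeType 4 X 4 2 2 c → c ∈ supportedClasses X 4 1) :
    MiddleHodge 2 :=
  middleHodge_two_iff_middleDivisorSupportFourfold.2 h

/-! ## Composition -/

/-- **Skeleton conclusion BY NAME — the ladder closes the crux** (consumes the registered stubs, one
application): rung `2` and the gap give `HodgeConjectureFor n X` for every smooth projective `X`, in
particular off the anchors (the anchor exclusions are simply not used).  This is the FIRST theorem of the
file concluding the crux, so it is the one the skeleton check registers. -/
theorem HodgeBeyondAnchors_of : HodgeBeyondAnchors :=
  fun _n _X hX _ _ ↦ stub_summitGrantedFourfolds stub_middleHodge_two hX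

/-- The same composition in hypothesis form (stub statements verbatim), concluding the SUMMIT (so that
`HodgeBeyondAnchors_of` stays the only theorem of the file whose conclusion is the crux by name; the crux
follows from the summit by the landed `hodgeBeyondAnchors_iff_hodgeConjecture_holds`).  This is the typed
ladder `Rung 2 → Gap → S`. -/
theorem hodgeConjecture_of_rungs
    (h2 : ∀ ⦃X : SchemeOver ℂ⦄, IsSmoothProjective 4 X →
      ∀ c : complexBetti X (2 * 2), IsRationalClass c → IsOfHodgeType 4 X (2 * 2) 2 2 c →
        c ∈ algebraicClasses X 2)
    (hS : (∀ ⦃X : SchemeOver ℂ⦄, IsSmoothProjective 4 X →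
      ∀ c : complexBetti X (2 * 2), IsRationalClass c → IsOfHodgeType 4 X (2 * 2) 2 2 c →
        c ∈ algebraicClasses X 2) →
      ∀ ⦃n : ℕ⦄ ⦃X : SchemeOver ℂ⦄, IsSmoothProjective n X →
        Nonempty (HodgeModel n X) ∧ ∀ (p : ℕ) (c : complexBetti X (2 * p)), IsRationalClass c →
          IsOfHodgeType n X (2 * p) p p c → c ∈ algebraicClasses X p) :
    _root_.HodgeConjecture :=
  fun _n _X hX ↦ hS h2 hX

/-- Sanity: the gap alone is the landed reduction once the rung is granted — with the rung as a
HYPOTHESIS the gap's conclusion follows from `hodgeConjectureFor_of_middleDimension_holds` only together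
with all higher rungs, which is why the gap is a genuine (conditional) item and not glue. The floor
direction is glue: the summit gives every rung (on-path test `S → Rung m`, kernel-proved). -/
theorem middleHodge_of_hodgeConjecture (h : _root_.HodgeConjecture) (m : ℕ) : MiddleHodge m :=
  forall_middleHodge_iff_hodgeConjecture.2 h m

end Summit.HodgeConjecture.HodgeConjecture.Cruxes.HodgeBeyondAnchors.MiddleHodgeLadder

end
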